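import Summits.CriticalPhenomena.Ising3DConformalLimit.Theses.SubPtolemyInterlacing
import Literature.Probability.LatticeModels.CriticalScalingDimension
import Literature.Probability.LatticeModels.CriticalUrsellFourSign
import HarnessLib

/-!
# `SubPtolemyInterlacing.InterlacingForcesU4` (item stmt-CriticalPhenomena-15704), proved

THEOREM-ONLY file (no definitions, no named facts). The crux `InterlacingForcesU4` of route
`SubPtolemyInterlacing` of the sub-problem `Ising3DConformalLimit`:

`Interlacing → SubPtolemyFloor → ∀ ρ Δ S, (ρ > 0 on (0,1]) → HasPointwiseScalingLimit (criticalCorr 3) ρ S →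
IsNondegenerateTwoPoint S → IsTranslationInvariant S → IsScaleCovariant Δ S → HasNontrivialU4 S`.

Line `dyadic-doubling-balanced` (crux workfile `Cruxes/InterlacingForcesU4/SketchDyadicDoublingBalanced.lean`,
re-homed here up to names, with the sketch's abbreviations `t e₁ = single 0 t`, `x⋆`, `m e₁` written
out, so the file declares theorems only):

* run the argument along the dyadic meshes `δ_k = 2^{-(k+1)}` at the Ptolemy-balanced configuration
  `x⋆ = (0,2,3,6)·e₁`, where every lattice approximant is an EXACT axis site `(0, 2N, 3N, 6N)·e₁`,
  `N = 2^{k+1}` (`latticeApprox_dyadic_unitVec`), i.e. `Interlacing`'s quadruple at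
  `(a,b,c) = (2N, N, 3N)`; multiplied by `ρ(δ_k)⁸ ≥ 0` the lattice inequality passes to the limit
  (`interlacingForcesU4_limit_subPtolemy`);
* keep the scaling dimension only through the doubling ratio `u = 2^{-2Δ}` and the two numbers
  `s₁ = S₂(0,e₁)`, `s₃ = S₂(0,3e₁)`: two axis translations and scale covariance at `c = 2` turn the
  six pair values at `x⋆` into `u s₁, s₃, s₃, u² s₁, u s₃, s₁`, so the limit inequality reads
  `S₄(x⋆) ≤ s₁ s₃` and `U₄(x⋆) ≤ s₁ s₃ (1 - 2u - u²)`;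
* the floor gives `2Δ ≤ a` by the one-sided (upper) half of the dyadic argument of
  `scalingDimension_mem_Icc_of_bounds` (`tendsto_log_rho_sq_div`, `tendsto_rescaled_dyadic`), and
  `2Δ ≤ a < log₂(1+√2)` is exactly `u > √2 - 1`, where `1 - 2u - u² < 0`; hence `U₄(x⋆) < 0`.

References (informal provenance only; every input is a theorem of the tree or an antecedent):
Duminil-Copin ICM 2022 §8.1; Aizenman CMP 86 (1982) §1; Di Francesco–Mathieu–Sénéchal 1997 §4.3.1.
-/

noncomputable section

namespace Summit.CriticalPhenomena.Ising3DConformalLimit.Theorems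

open Filter Topology
open Literature.Probability.LatticeModels
open Summit.CriticalPhenomena.Ising3DConformalLimit.Theses
open Summit.CriticalPhenomena.Ising3DConformalLimit.Theses.SubPtolemyInterlacing
open EuclideanSpace (single)

-- Throughout: `single 0 t = t e₁ ∈ ℝ³`, `x⋆ = ![0, single 0 2, single 0 3, single 0 6]`, `m e₁ = Pi.single 0 m ∈ ℤ³`.

/-- `x⋆ = (0, 2e₁, 3e₁, 6e₁)` is non-coincident (read the first coordinate). [folklore] -/
theorem interlacingForcesU4_xStar_mem_nonCoincident :
    (![0, single 0 2, single 0 3, single 0 6] : Fin 4 → EuclideanSpace ℝ (Fin 3)) ∈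
      NonCoincident 3 4 := by
  rw [mem_nonCoincident]
  intro i j hij
  have h := congrArg (fun v : EuclideanSpace ℝ (Fin 3) => v 0) hij
  fin_cases i <;> fin_cases j <;> first | rfl | norm_num at h

/-- `(m:ℤ) • e₁ = Pi.single 0 m` in `ℤ³` (the axis sites of `Interlacing`). [folklore] -/
theorem interlacingForcesU4_axSite_eq (m : ℕ) :
    ((m : ℤ) • (Pi.single 0 1 : Site 3)) = Pi.single (0 : Fin 3) (m : ℤ) := by
  funext i
  fin_cases i <;> simp

/-- **Dyadic exactness at `x⋆`**: at mesh `δ_k = 2^{-(k+1)}` the lattice approximants of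
`x⋆ = (0,2,3,6)·e₁` are the axis sites `0, 2N e₁, 3N e₁, 6N e₁` with `N = 2^{k+1}` — `Interlacing`'s
quadruple `(0, a, a+b, a+b+c)` with `(a, b, c) = (2N, N, 3N)`, no floor error
(`latticeApprox_dyadic_unitVec`). [folklore] -/
theorem interlacingForcesU4_latticeApprox_xStar (k : ℕ) :
    (fun i => latticeApprox ((2:ℝ)⁻¹ ^ (k + 1))
      ((![0, single 0 2, single 0 3, single 0 6] : Fin 4 → EuclideanSpace ℝ (Fin 3)) i)) =
      ![Pi.single 0 ((0 : ℕ) : ℤ), Pi.single 0 ((2 * 2 ^ (k + 1) : ℕ) : ℤ),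
        Pi.single 0 ((3 * 2 ^ (k + 1) : ℕ) : ℤ), Pi.single 0 ((6 * 2 ^ (k + 1) : ℕ) : ℤ)] := by
  have h2 := latticeApprox_dyadic_unitVec k 2
  have h3 := latticeApprox_dyadic_unitVec k 3
  have h6 := latticeApprox_dyadic_unitVec k 6
  push_cast at h2 h3 h6 ⊢
  funext i
  fin_cases i
  · simp [latticeApprox_zero]
  · simpa using h2
  · simpa using h3
  · simpa using h6

/-- **The lattice input**, read off `Interlacing` at `(a,b,c) = (2N, N, 3N)` (`N ≥ 1`): the
sub-Ptolemy inequality for the critical correlators at the axis quadruple `(0, 2N, 3N, 6N)·e₁`.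
[folklore] -/
theorem interlacingForcesU4_interlacing_balanced (hI : Interlacing) (N : ℕ) (hN : 1 ≤ N) :
    criticalCorr 3 4 ![Pi.single 0 ((0 : ℕ) : ℤ), Pi.single 0 ((2 * N : ℕ) : ℤ),
        Pi.single 0 ((3 * N : ℕ) : ℤ), Pi.single 0 ((6 * N : ℕ) : ℤ)] *
        (criticalCorr 3 2 ![Pi.single 0 ((0 : ℕ) : ℤ), Pi.single 0 ((3 * N : ℕ) : ℤ)] *
          criticalCorr 3 2 ![Pi.single 0 ((2 * N : ℕ) : ℤ), Pi.single 0 ((6 * N : ℕ) : ℤ)]) ≤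
      criticalCorr 3 2 ![Pi.single 0 ((0 : ℕ) : ℤ), Pi.single 0 ((2 * N : ℕ) : ℤ)] *
          criticalCorr 3 2 ![Pi.single 0 ((3 * N : ℕ) : ℤ), Pi.single 0 ((6 * N : ℕ) : ℤ)] *
        (criticalCorr 3 2 ![Pi.single 0 ((0 : ℕ) : ℤ), Pi.single 0 ((6 * N : ℕ) : ℤ)] *
          criticalCorr 3 2 ![Pi.single 0 ((2 * N : ℕ) : ℤ), Pi.single 0 ((3 * N : ℕ) : ℤ)]) := by
  have h := hI (2 * N) N (3 * N) (by omega) hN (by omega)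
  have e3 : 2 * N + N = 3 * N := by ring
  have e6 : 2 * N + N + 3 * N = 6 * N := by ring
  simp only [interlacingForcesU4_axSite_eq] at h
  rw [e6, e3] at h
  exact h

/-- **Limit passage of the sub-Ptolemy inequality at `x⋆` (eventual balanced dyadic form).** If the
lattice inequality holds at `(0, 2N, 3N, 6N)·e₁`, `N = 2^{k+1}`, for all `k ≥ K`, then for every
pointwise scaling limit `S` of the critical correlators (any renormalisation `ρ`; its sign is
irrelevant since the inequality is multiplied by `ρ(δ_k)⁸`), at `x = x⋆`,
`S₄(x)·S₂(x₀,x₂)S₂(x₁,x₃) ≤ S₂(x₀,x₁)S₂(x₂,x₃)·S₂(x₀,x₃)S₂(x₁,x₂)`: seven rescaled correlators at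
`x⋆` and its ordered sub-pairs converge along `tendsto_dyadicMesh` (`(hlim 4).tendsto_at`,
`(hlim 2).tendsto_at`, `pair_mem_nonCoincident`), dyadic exactness identifies the lattice sites,
and `le_of_tendsto_of_tendsto` closes. No `ρ > 0`, no covariance, no floor, no continuity of `S`.
[cite: DuminilCopinICM2022, §8.1] -/
theorem interlacingForcesU4_limit_subPtolemy' {ρ : ℝ → ℝ} {S : CorrFamily 3}
    (x : Fin 4 → EuclideanSpace ℝ (Fin 3)) (hx : x = ![0, single 0 2, single 0 3, single 0 6]) (K : ℕ)
    (hK : ∀ k : ℕ, K ≤ k →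
      criticalCorr 3 4 ![Pi.single 0 ((0 : ℕ) : ℤ), Pi.single 0 ((2 * 2 ^ (k + 1) : ℕ) : ℤ),
          Pi.single 0 ((3 * 2 ^ (k + 1) : ℕ) : ℤ), Pi.single 0 ((6 * 2 ^ (k + 1) : ℕ) : ℤ)] *
          (criticalCorr 3 2 ![Pi.single 0 ((0 : ℕ) : ℤ), Pi.single 0 ((3 * 2 ^ (k + 1) : ℕ) : ℤ)] *
            criticalCorr 3 2 ![Pi.single 0 ((2 * 2 ^ (k + 1) : ℕ) : ℤ),
              Pi.single 0 ((6 * 2 ^ (k + 1) : ℕ) : ℤ)]) ≤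
        criticalCorr 3 2 ![Pi.single 0 ((0 : ℕ) : ℤ), Pi.single 0 ((2 * 2 ^ (k + 1) : ℕ) : ℤ)] *
            criticalCorr 3 2 ![Pi.single 0 ((3 * 2 ^ (k + 1) : ℕ) : ℤ),
              Pi.single 0 ((6 * 2 ^ (k + 1) : ℕ) : ℤ)] *
          (criticalCorr 3 2 ![Pi.single 0 ((0 : ℕ) : ℤ), Pi.single 0 ((6 * 2 ^ (k + 1) : ℕ) : ℤ)] *
            criticalCorr 3 2 ![Pi.single 0 ((2 * 2 ^ (k + 1) : ℕ) : ℤ),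
              Pi.single 0 ((3 * 2 ^ (k + 1) : ℕ) : ℤ)]))
    (hlim : HasPointwiseScalingLimit (criticalCorr 3) ρ S) :
    S 4 x * (S 2 ![x 0, x 2] * S 2 ![x 1, x 3]) ≤
      S 2 ![x 0, x 1] * S 2 ![x 2, x 3] * (S 2 ![x 0, x 3] * S 2 ![x 1, x 2]) := by
  have hxmem : x ∈ NonCoincident 3 4 := hx ▸ interlacingForcesU4_xStar_mem_nonCoincident
  have hinj : Function.Injective x := hxmem
  set δ : ℕ → ℝ := fun k => (2 : ℝ)⁻¹ ^ (k + 1) with hδ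
  -- the seven convergent sequences along the dyadic meshes
  have hpair : ∀ i j, i ≠ j → Tendsto
      (fun k : ℕ => ρ (δ k) ^ 2 * criticalCorr 3 2 ![latticeApprox (δ k) (x i), latticeApprox (δ k) (x j)])
      atTop (𝓝 (S 2 ![x i, x j])) := by
    intro i j hij
    have hmem : (![x i, x j] : Fin 2 → EuclideanSpace ℝ (Fin 3)) ∈ NonCoincident 3 2 :=
      pair_mem_nonCoincident fun h => hij (hinj h)
    have h := ((hlim 2).tendsto_at hmem).comp tendsto_dyadicMesh
    refine h.congr fun k => ?_
    simp only [Function.comp_apply, rescaledCorrelator_apply, latticeApprox_comp_two]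
    rfl
  have h4 : Tendsto (fun k : ℕ => ρ (δ k) ^ 4 * criticalCorr 3 4 (fun i => latticeApprox (δ k) (x i)))
      atTop (𝓝 (S 4 x)) := by
    have h := ((hlim 4).tendsto_at hxmem).comp tendsto_dyadicMesh
    refine h.congr fun k => ?_
    simp only [Function.comp_apply, rescaledCorrelator_apply]
    rfl
  have hL := h4.mul ((hpair 0 2 (by decide)).mul (hpair 1 3 (by decide)))
  have hR := ((hpair 0 1 (by decide)).mul (hpair 2 3 (by decide))).mul ((hpair 0 3 (by decide)).mul
    (hpair 1 2 (by decide)))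
  refine le_of_tendsto_of_tendsto hL hR ?_
  filter_upwards [eventually_ge_atTop K] with k hk
  -- at mesh `δ_k` every approximant is an exact axis site (dyadic exactness)
  have hxs : (fun i => latticeApprox (δ k) (x i)) =
      ![Pi.single 0 ((0 : ℕ) : ℤ), Pi.single 0 ((2 * 2 ^ (k + 1) : ℕ) : ℤ),
        Pi.single 0 ((3 * 2 ^ (k + 1) : ℕ) : ℤ), Pi.single 0 ((6 * 2 ^ (k + 1) : ℕ) : ℤ)] := by
    rw [hx]; exact interlacingForcesU4_latticeApprox_xStar k
  have happ : ∀ i, latticeApprox (δ k) (x i) =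
      (![Pi.single 0 ((0 : ℕ) : ℤ), Pi.single 0 ((2 * 2 ^ (k + 1) : ℕ) : ℤ),
        Pi.single 0 ((3 * 2 ^ (k + 1) : ℕ) : ℤ), Pi.single 0 ((6 * 2 ^ (k + 1) : ℕ) : ℤ)] :
        Fin 4 → Site 3) i := fun i => congrFun hxs i
  have hlat := hK k hk
  have h8 : 0 ≤ ρ (δ k) ^ 8 := Even.pow_nonneg (by decide) _
  have hmul := mul_le_mul_of_nonneg_left hlat h8
  show ρ (δ k) ^ 4 * criticalCorr 3 4 (fun i => latticeApprox (δ k) (x i)) *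
      (ρ (δ k) ^ 2 * criticalCorr 3 2 ![latticeApprox (δ k) (x 0), latticeApprox (δ k) (x 2)] *
        (ρ (δ k) ^ 2 * criticalCorr 3 2 ![latticeApprox (δ k) (x 1), latticeApprox (δ k) (x 3)])) ≤
    ρ (δ k) ^ 2 * criticalCorr 3 2 ![latticeApprox (δ k) (x 0), latticeApprox (δ k) (x 1)] *
      (ρ (δ k) ^ 2 * criticalCorr 3 2 ![latticeApprox (δ k) (x 2), latticeApprox (δ k) (x 3)]) *
      (ρ (δ k) ^ 2 * criticalCorr 3 2 ![latticeApprox (δ k) (x 0), latticeApprox (δ k) (x 3)] *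
        (ρ (δ k) ^ 2 * criticalCorr 3 2 ![latticeApprox (δ k) (x 1), latticeApprox (δ k) (x 2)]))
  rw [hxs, happ 0, happ 1, happ 2, happ 3]
  simp only [Matrix.cons_val_zero, Matrix.cons_val_one, Matrix.head_cons, Matrix.cons_val_two,
    Matrix.tail_cons, Matrix.cons_val_three]
  nlinarith [hmul]

/-- **Limit sub-Ptolemy inequality at `x⋆ = (0,2,3,6)·e₁` from `Interlacing`** (the eventual form
with `K = 0`, `N = 2^{k+1} ≥ 1`), pair values written out. [cite: DuminilCopinICM2022, §8.1] -/
theorem interlacingForcesU4_limit_subPtolemy {ρ : ℝ → ℝ} {S : CorrFamily 3} (hI : Interlacing)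
    (hlim : HasPointwiseScalingLimit (criticalCorr 3) ρ S) :
    S 4 ![0, single 0 2, single 0 3, single 0 6] *
        (S 2 ![0, single 0 3] * S 2 ![single 0 2, single 0 6]) ≤
      S 2 ![0, single 0 2] * S 2 ![single 0 3, single 0 6] *
        (S 2 ![0, single 0 6] * S 2 ![single 0 2, single 0 3]) :=
  interlacingForcesU4_limit_subPtolemy' _ rfl 0
    (fun k _ => interlacingForcesU4_interlacing_balanced hI (2 ^ (k + 1)) Nat.one_le_two_pow) hlim

/-- **Translation bookkeeping on the axis**: `S₂(s e₁, t e₁) = S₂(0, (t-s) e₁)`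
(`IsTranslationInvariant` with `v = -s e₁`). [cite: FrancescoMathieuSenechal1997, §4.3.1] -/
theorem interlacingForcesU4_S_two_axis_translate {S : CorrFamily 3} (htr : IsTranslationInvariant S)
    (s t : ℝ) : S 2 ![single 0 s, single 0 t] = S 2 ![0, single 0 (t - s)] := by
  have h := htr 2 (-(single 0 s)) ![single 0 s, single 0 t]
  rw [← h]
  congr 1
  funext i
  fin_cases i
  · simp
  · simp only [Fin.mk_one, Matrix.cons_val_one, Matrix.cons_val_fin_one]
    ext j
    simp
    split_ifs <;> ring

/-- **Doubling on the axis**: `S₂(0, 2t e₁) = 2^{-2Δ} S₂(0, t e₁)` (`IsScaleCovariant` at `c = 2`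
only). [cite: FrancescoMathieuSenechal1997, §4.3.1  eq. (4.62] -/
theorem interlacingForcesU4_S_two_axis_double {S : CorrFamily 3} {Δ : ℝ} (hsc : IsScaleCovariant Δ S)
    (t : ℝ) : S 2 ![0, single 0 (2 * t)] = (2:ℝ) ^ (-(2:ℝ) * Δ) * S 2 ![0, single 0 t] := by
  have h := hsc 2 2 (by norm_num) ![0, single 0 t]
  have hcfg : (fun i => (2:ℝ) • (![0, single 0 t] : Fin 2 → EuclideanSpace ℝ (Fin 3)) i) =
      ![0, single 0 (2 * t)] := by
    funext i
    fin_cases i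
    · simp
    · simp only [Fin.mk_one, Matrix.cons_val_one, Matrix.cons_val_fin_one]
      ext j
      simp
  rw [hcfg] at h
  rw [h]
  norm_num

/-- **Floor ⇒ `2Δ ≤ a`.** If `c n^{-a} ≤ ⟨σ₀σ_{n e₁}⟩⁺_{β_c}` for all `n ≥ 1` (`c > 0`), then every
scale-covariant non-degenerate pointwise scaling limit with renormalisation `ρ > 0` on `(0,1]` has
`2Δ ≤ a`: one-sided re-run of the upper half of `scalingDimension_mem_Icc_of_bounds` —
`log ρ(δ_k)²/k → 2Δ log 2` (`tendsto_log_rho_sq_div`), `ρ(δ_k)² G(2^{k+1}e₁) → s₁ > 0`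
(`tendsto_rescaled_dyadic`), and the floor gives `log ρ(δ_k)² ≤ log (2 s₁) - log c + a (k+1) log 2`.
[cite: DuminilCopin2019, Thm. 4.8, §4.4] -/
theorem interlacingForcesU4_two_mul_dim_le_of_axialFloor {ρ : ℝ → ℝ} {Δ : ℝ} {S : CorrFamily 3}
    {a c : ℝ} (hc : 0 < c)
    (hfloor : ∀ n : ℕ, 1 ≤ n → c * (n : ℝ) ^ (-a) ≤
      criticalTwoPoint 3 ((n : ℤ) • (Pi.single 0 1 : Site 3)))
    (hρ : ∀ δ ∈ Set.Ioc (0:ℝ) 1, 0 < ρ δ) (hlim : HasPointwiseScalingLimit (criticalCorr 3) ρ S)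
    (hnd : IsNondegenerateTwoPoint S) (hsc : IsScaleCovariant Δ S) : 2 * Δ ≤ a := by
  set δ : ℕ → ℝ := fun k => (2 : ℝ)⁻¹ ^ (k + 1) with hδ
  set G : ℕ → ℝ := fun k =>
    criticalTwoPoint 3 (Pi.single (0 : Fin 3) (((1 : ℕ) : ℤ) * 2 ^ (k + 1))) with hG
  set r : ℕ → ℝ := fun k => ρ (δ k) ^ 2 * G k with hr
  set s₁ := S 2 ![0, EuclideanSpace.single (0 : Fin 3) ((1 : ℕ) : ℝ)] with hs₁
  have hs₁pos : 0 < s₁ := hnd _ (zero_unitVec_mem_nonCoincident (by norm_num))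
  have hρk : ∀ k : ℕ, 0 < ρ (δ k) := fun k => hρ _ ⟨dyadicMesh_pos k, dyadicMesh_le_one k⟩
  -- the floor at `n = 2^{k+1}`: `c (2^{k+1})^{-a} ≤ G k`
  have hsite : ∀ k : ℕ, (((2 ^ (k + 1) : ℕ) : ℤ) • (Pi.single 0 1 : Site 3)) =
      Pi.single (0 : Fin 3) (((1 : ℕ) : ℤ) * 2 ^ (k + 1)) := by
    intro k
    funext i
    fin_cases i <;> simp
  have hlow : ∀ k : ℕ, c * ((2 : ℝ) ^ (k + 1)) ^ (-a) ≤ G k := by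
    intro k
    have h := hfloor (2 ^ (k + 1)) Nat.one_le_two_pow
    rw [hsite k] at h
    push_cast at h
    exact h
  have hGpos : ∀ k, 0 < G k := fun k =>
    lt_of_lt_of_le (mul_pos hc (Real.rpow_pos_of_pos (by positivity) _)) (hlow k)
  -- `r k → s₁ > 0`, hence eventually `r k ≤ 2 s₁`
  have hrlim : Tendsto r atTop (𝓝 s₁) := tendsto_rescaled_dyadic hlim (t := 1) one_ne_zero
  have hr_ev : ∀ᶠ k in atTop, r k ≤ 2 * s₁ :=
    (hrlim.eventually_lt_const (by linarith)).mono fun k hk => hk.le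
  have hmain := tendsto_log_rho_sq_div hlim hsc hnd hρ  -- `log ρ(δ_k)² / k → 2Δ log 2` (tree)
  have hlog2 : 0 < Real.log 2 := Real.log_pos (by norm_num)
  have hlogeq : ∀ k, Real.log (ρ (δ k) ^ 2) = Real.log (r k) - Real.log (G k) := by
    intro k
    rw [hr]
    simp only
    rw [Real.log_mul (pow_ne_zero _ (hρk k).ne') (hGpos k).ne']
    ring
  have hpowa : ∀ k : ℕ, Real.log (((2 : ℝ) ^ (k + 1)) ^ (-a)) = -(a * ((k + 1 : ℝ) * Real.log 2)) := by
    intro k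
    rw [Real.log_rpow (by positivity), Real.log_pow]
    push_cast
    ring
  have hUB : ∀ᶠ k : ℕ in atTop,
      Real.log (ρ (δ k) ^ 2) / k ≤
        (Real.log (2 * s₁) - Real.log c + a * ((k + 1 : ℝ) * Real.log 2)) / k := by
    filter_upwards [hr_ev, eventually_gt_atTop 0] with k hrk hk
    have hk' : (0 : ℝ) < k := by exact_mod_cast hk
    rw [div_le_div_iff_of_pos_right hk', hlogeq k]
    have hpw : 0 < ((2 : ℝ) ^ (k + 1)) ^ (-a) := Real.rpow_pos_of_pos (by positivity) _
    have h1 : Real.log c + Real.log (((2 : ℝ) ^ (k + 1)) ^ (-a)) ≤ Real.log (G k) := by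
      rw [← Real.log_mul hc.ne' hpw.ne']
      exact Real.log_le_log (mul_pos hc hpw) (hlow k)
    have hrpos : 0 < r k := mul_pos (pow_pos (hρk k) 2) (hGpos k)
    have h2 : Real.log (r k) ≤ Real.log (2 * s₁) := Real.log_le_log hrpos hrk
    rw [hpowa k] at h1
    linarith
  have hinvk : Tendsto (fun k : ℕ => (k : ℝ)⁻¹) atTop (𝓝 0) :=
    tendsto_inv_atTop_zero.comp tendsto_natCast_atTop_atTop
  have hUBlim : Tendsto (fun k : ℕ =>
      (Real.log (2 * s₁) - Real.log c + a * ((k + 1 : ℝ) * Real.log 2)) / k)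
      atTop (𝓝 (a * Real.log 2)) := by
    have h : ∀ k : ℕ, 0 < k →
        (Real.log (2 * s₁) - Real.log c + a * ((k + 1 : ℝ) * Real.log 2)) / k =
          (Real.log (2 * s₁) - Real.log c + a * Real.log 2) * (k : ℝ)⁻¹ + a * Real.log 2 := by
      intro k hk
      have hk' : (k : ℝ) ≠ 0 := by exact_mod_cast hk.ne'
      field_simp
      ring
    have hl := (hinvk.const_mul (Real.log (2 * s₁) - Real.log c + a * Real.log 2)).add_const
      (a * Real.log 2)
    rw [mul_zero, zero_add] at hl
    refine hl.congr' ?_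
    filter_upwards [eventually_gt_atTop 0] with k hk using (h k hk).symm
  have hle : 2 * Δ * Real.log 2 ≤ a * Real.log 2 := le_of_tendsto_of_tendsto hmain hUBlim hUB
  nlinarith

/-- **Threshold arithmetic**: `2Δ ≤ a < log₂(1+√2)` ⇒ `√2 - 1 < u = 2^{-2Δ}` (rpow monotonicity
in the exponent, `2^{-log₂(1+√2)} = (1+√2)⁻¹ = √2 - 1`). [folklore] -/
theorem interlacingForcesU4_sqrt_two_sub_one_lt_doublingRatio {a Δ : ℝ}
    (ha : a < Real.logb 2 (1 + Real.sqrt 2)) (hΔ : 2 * Δ ≤ a) :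
    Real.sqrt 2 - 1 < (2:ℝ) ^ (-(2:ℝ) * Δ) := by
  have h1 : (2:ℝ) ^ (-a) ≤ (2:ℝ) ^ (-(2:ℝ) * Δ) :=
    Real.rpow_le_rpow_of_exponent_le one_le_two (by linarith)
  have h2 : (2:ℝ) ^ (-(Real.logb 2 (1 + Real.sqrt 2))) < (2:ℝ) ^ (-a) :=
    Real.rpow_lt_rpow_of_exponent_lt one_lt_two (by linarith)
  have hpos : 0 < 1 + Real.sqrt 2 := by positivity
  have h3 : (2:ℝ) ^ (-(Real.logb 2 (1 + Real.sqrt 2))) = Real.sqrt 2 - 1 := by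
    rw [Real.rpow_neg (by norm_num), Real.rpow_logb (by norm_num) (by norm_num) hpos]
    have hs : Real.sqrt 2 ^ 2 = 2 := Real.sq_sqrt (by norm_num)
    have hkey : (1 + Real.sqrt 2) * (Real.sqrt 2 - 1) = 1 := by nlinarith [hs]
    exact inv_eq_of_mul_eq_one_right hkey
  linarith [h1, h2, h3]

/-- **Algebraic core at the balanced point.** With `s₁ = S₂(0,e₁)`, `s₃ = S₂(0,3e₁)`,
`u = 2^{-2Δ}`: the six pair values at `x⋆` are `S₂(01) = u s₁`, `S₂(23) = s₃`, `S₂(02) = s₃`,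
`S₂(13) = u² s₁`, `S₂(03) = u s₃`, `S₂(12) = s₁`; the limit sub-Ptolemy inequality reads
`S₄ · (s₃ · u² s₁) ≤ (u s₁ · s₃) · (u s₃ · s₁)`, i.e. `S₄ ≤ s₁ s₃`, and the Wick sum is
`s₁ s₃ (2u + u²)`, so `U₄(x⋆) ≤ s₁ s₃ (1 - 2u - u²) < 0` once `u > √2 - 1`. [folklore] -/
theorem interlacingForcesU4_u4_balanced_neg {S4 s1 s3 u : ℝ} (hs1 : 0 < s1) (hs3 : 0 < s3)
    (hu0 : 0 < u) (hu : Real.sqrt 2 - 1 < u)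
    (hspc : S4 * (s3 * (u ^ 2 * s1)) ≤ (u * s1) * s3 * ((u * s3) * s1)) :
    S4 - ((u * s1) * s3 + s3 * (u ^ 2 * s1) + (u * s3) * s1) < 0 := by
  have hpos : 0 < s3 * (u ^ 2 * s1) := by positivity
  have hS4 : S4 ≤ s1 * s3 := by
    have h' : S4 * (s3 * (u ^ 2 * s1)) ≤ (s1 * s3) * (s3 * (u ^ 2 * s1)) := by nlinarith [hspc]
    exact le_of_mul_le_mul_right h' hpos
  have hs : Real.sqrt 2 ^ 2 = 2 := Real.sq_sqrt (by norm_num)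
  have hq : 1 - 2 * u - u ^ 2 < 0 := by nlinarith [hu, hs, Real.sqrt_nonneg 2]
  nlinarith [hS4, hq, mul_pos hs1 hs3, mul_pos (mul_pos hs1 hs3) hu0]

/-- **`InterlacingForcesU4` (item stmt-CriticalPhenomena-15704 of route `SubPtolemyInterlacing`),
proved**: `Interlacing → SubPtolemyFloor →` for every renormalisation `ρ > 0` on `(0,1]`, every `Δ`
and every pointwise scaling limit `S` of `criticalCorr 3` that is non-degenerate, translation
invariant and scale covariant with dimension `Δ`, `HasNontrivialU4 S`. At the Ptolemy-balanced
configuration `x⋆ = (0,2,3,6)·e₁`: the limit sub-Ptolemy inequality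
(`interlacingForcesU4_limit_subPtolemy`, from `Interlacing` at the balanced dyadic quadruples), two
axis translations and scale covariance at `c = 2` give `U₄(x⋆) ≤ s₁ s₃ (1 - 2u - u²)` with
`u = 2^{-2Δ}`; the floor gives `2Δ ≤ a` (`interlacingForcesU4_two_mul_dim_le_of_axialFloor`), so
`u > √2 - 1` and `U₄(x⋆) < 0`. Settles item stmt-CriticalPhenomena-15704 (exact signature).
[cite: DuminilCopinICM2022, §8.1] [cite: Aizenman1982, §1] -/
theorem interlacingForcesU4_proof : SubPtolemyInterlacing.InterlacingForcesU4 := by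
  unfold SubPtolemyInterlacing.InterlacingForcesU4
  intro hI hF ρ Δ S hρ hlim hnd htr hsc
  obtain ⟨a, c, ha, hc, hfloor⟩ := hF
  -- the doubling ratio `u = 2^{-2Δ}` and its lower bound from the floor
  set u : ℝ := (2:ℝ) ^ (-(2:ℝ) * Δ) with hu
  have hu0 : 0 < u := Real.rpow_pos_of_pos (by norm_num) _
  have hΔa : 2 * Δ ≤ a := interlacingForcesU4_two_mul_dim_le_of_axialFloor hc hfloor hρ hlim hnd hsc
  have huroot : Real.sqrt 2 - 1 < u := interlacingForcesU4_sqrt_two_sub_one_lt_doublingRatio ha hΔa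
  -- the two positive numbers `s₁ = S₂(0,e₁)`, `s₃ = S₂(0,3e₁)`
  have hs1 : 0 < S 2 ![0, single 0 1] := hnd _ (zero_unitVec_mem_nonCoincident one_ne_zero)
  have hs3 : 0 < S 2 ![0, single 0 3] := hnd _ (zero_unitVec_mem_nonCoincident (by norm_num))
  -- doubling (scale covariance at `c = 2`) and axis translations: the six pair values at `x⋆`
  have e01 : S 2 ![0, single 0 2] = u * S 2 ![0, single 0 1] := by
    have h := interlacingForcesU4_S_two_axis_double hsc 1
    rw [mul_one] at h
    rw [hu]; exact h
  have hd2 : S 2 ![0, single 0 4] = u * S 2 ![0, single 0 2] := by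
    have h := interlacingForcesU4_S_two_axis_double hsc 2
    rw [show (2:ℝ) * 2 = 4 by norm_num] at h
    rw [hu]; exact h
  have e03 : S 2 ![0, single 0 6] = u * S 2 ![0, single 0 3] := by
    have h := interlacingForcesU4_S_two_axis_double hsc 3
    rw [show (2:ℝ) * 3 = 6 by norm_num] at h
    rw [hu]; exact h
  have e13 : S 2 ![single 0 2, single 0 6] = u ^ 2 * S 2 ![0, single 0 1] := by
    have h := interlacingForcesU4_S_two_axis_translate htr 2 6
    rw [show (6:ℝ) - 2 = 4 by norm_num] at h
    rw [h, hd2, e01]; ring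
  have e23 : S 2 ![single 0 3, single 0 6] = S 2 ![0, single 0 3] := by
    have h := interlacingForcesU4_S_two_axis_translate htr 3 6
    rwa [show (6:ℝ) - 3 = 3 by norm_num] at h
  have e12 : S 2 ![single 0 2, single 0 3] = S 2 ![0, single 0 1] := by
    have h := interlacingForcesU4_S_two_axis_translate htr 2 3
    rwa [show (3:ℝ) - 2 = 1 by norm_num] at h
  -- the limit sub-Ptolemy inequality at `x⋆`, in the `(s₁, s₃, u)` bookkeeping
  have hspc := interlacingForcesU4_limit_subPtolemy hI hlim
  rw [e01, e23, e13, e03, e12] at hspc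
  -- conclude: `U₄(x⋆) < 0`
  refine ⟨![0, single 0 2, single 0 3, single 0 6], interlacingForcesU4_xStar_mem_nonCoincident,
    ne_of_lt ?_⟩
  show S 4 ![0, single 0 2, single 0 3, single 0 6] -
      (S 2 ![0, single 0 2] * S 2 ![single 0 3, single 0 6] +
        S 2 ![0, single 0 3] * S 2 ![single 0 2, single 0 6] +
        S 2 ![0, single 0 6] * S 2 ![single 0 2, single 0 3]) < 0
  rw [e01, e23, e13, e03, e12]
  exact interlacingForcesU4_u4_balanced_neg hs1 hs3 hu0 huroot hspc

end Summit.CriticalPhenomena.Ising3DConformalLimit.Theorems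

end
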